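import Literature.AlgebraicGeometry.Resolution.WeightedCentreGradedAutomorphism
import Mathlib.Algebra.MvPolynomial.PDeriv
import Mathlib.Algebra.CharP.Defs
import HarnessLib

/-!
# The layer equation (⋆): first-order Taylor expansion in block degree

Uniform value line: typed theorems in the polynomial weighted-centre model `W(f)` — NOT a
resolution theorem, NOT summit progress; AI review is weaker than expert review.

Setting (the block step of the straightening argument, polynomial model).  Fix a finite set of
variables `B` (a *block*: in the application, the centre variables of one common weight) and
grade `MvPolynomial σ K` by the **block degree** `blockWeight B` (weight `1` on `B`, `0` off `B`);
`[P]ₘ := weightedHomogeneousComponent (blockWeight B) m P` is the part of `P` of `B`-degree `m`.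
A **block substitution** is an algebra endomorphism `ψ` with
`ψ (X k) = X k + S k` for `k ∈ B`, where the shifts `S k` and the images `ψ (X i)` (`i ∉ B`) are
`B`-free (block degree `0`).  In the application `ψ` is the graded substitution `θ_Y` of an
inverse normal form at `t = 1` (see `WeightedCentreFaceEquation`): it fixes the variables above
the block, shifts the block by polynomials in the lower variables, and maps the lower variables
among themselves.  Its **flat part** `ψ♭ := blockFlat B ψ` is the identity on the block and `ψ`
off the block, and its **first-order part** is
`blockDifferential B ψ S P := Σ_{k ∈ B} S k · ψ♭ (∂P/∂X_k)`.

Main statements (all derived here; they are the polynomial identities behind the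
"translational move" `F ↦ F(y + t, z)` of the classical literature):
* `IsBlockSubstitution.weightedHomogeneousComponent_map_top`: for `P` of block degree `n`,
  `[ψ P]ₙ = ψ♭ P`, and `[ψ P]ⱼ = 0` for `j > n` (`…_map_eq_zero_of_lt`);
* `IsBlockSubstitution.weightedHomogeneousComponent_map_sub_one` (first-order Taylor formula):
  for `P` of block degree `m + 1`, `[ψ P]ₘ = Σ_{k ∈ B} S k · ψ♭ (∂ₖ P)`;
* `IsBlockSubstitution.layer_eq` (the layer lemma): if every monomial of `H` has block degree
  `≤ m + 1`, then `[ψ H]ₘ = ψ♭ [H]ₘ + Σ_{k ∈ B} S k · ψ♭ (∂ₖ [H]ₘ₊₁)`;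
* `IsBlockSubstitution.layer_equation` ((⋆)): if moreover `ψ H = H - C c` (the face equation)
  and `m ≠ 0`, then `Σ_{k ∈ B} S k · ψ♭ (∂ₖ [H]ₘ₊₁) = [H]ₘ - ψ♭ [H]ₘ`, i.e. `M · S = -δ(n)` with
  the coefficient matrix read off `Σ_k S_k ∂ₖ` of the top layer — so `M(0) · v = 0` is literally
  `Σ_k v_k ∂ₖ f = 0` for the top forms `f`;
* `dvd_of_pderiv_eq_zero`, `notMem_vars_of_pderiv_eq_zero` (the derivative criterion in
  characteristic `p`): `∂ₖ F = 0` forces every exponent of `X k` in `F` to be divisible by `p`,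
  hence `X k` to be absent when these exponents are `< p`.

[cite: HauserWagner2014, (T) translational move F*(y,z) = F(yz+tz,z) (arXiv p. 14–15)]
[cite: AbramovichTemkinWlodarczyk2024, §3.4 (p. 1570) and §5.2 (pp. 1576–1577)]
[cite: Hironaka1970AdditiveGroups, additive forms and differential operators]
-/

open MvPolynomial Finsupp

namespace Literature.AlgebraicGeometry.Resolution.WeightedBlowup

variable {K : Type*} [Field K] {σ : Type*}

section Block

variable [DecidableEq σ]

/-! ## §1 Block degree, flat part, first-order part -/

/-- The **block degree**: the weight function which is `1` on the block `B` and `0` elsewhere, so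
that `weight (blockWeight B) d = Σ_{k ∈ B} d k` is the total degree of the monomial `d` in the block
variables (derived here; the grading of the block step).
[cite: AbramovichTemkinWlodarczyk2024, §3.4 (p. 1570)] -/
def blockWeight (B : Finset σ) : σ → ℕ := fun i => if i ∈ B then 1 else 0

variable {B : Finset σ}

/-- [cite: AbramovichTemkinWlodarczyk2024, §3.4 (p. 1570)] (derived here) -/
theorem blockWeight_of_mem {i : σ} (h : i ∈ B) : blockWeight B i = 1 := if_pos h

/-- [cite: AbramovichTemkinWlodarczyk2024, §3.4 (p. 1570)] (derived here) -/
theorem blockWeight_of_not_mem {i : σ} (h : i ∉ B) : blockWeight B i = 0 := if_neg h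

variable (B)

/-- The **flat part** `ψ♭` of an endomorphism `ψ` relative to the block `B`: the identity on the
block variables and `ψ` on the others (derived here; in the block step, `ψ♭` applies `ψ_>` to the
coefficients `n_{ν,β}(y_>)` of a `y_B`-expansion and leaves `y_B` alone).
[cite: HauserWagner2014, (T) translational move (arXiv p. 14)] -/
noncomputable def blockFlat (ψ : MvPolynomial σ K →ₐ[K] MvPolynomial σ K) :
    MvPolynomial σ K →ₐ[K] MvPolynomial σ K :=
  aeval fun i => if i ∈ B then X i else ψ (X i)

/-- The **first-order part** of a block substitution with shifts `S`:
`Σ_{k ∈ B} S k · ψ♭ (∂P/∂X_k)` (derived here; the left-hand side `M · S` of the layer equation).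
[cite: HauserWagner2014, (T) translational move (arXiv p. 14)] -/
noncomputable def blockDifferential (ψ : MvPolynomial σ K →ₐ[K] MvPolynomial σ K)
    (S : σ → MvPolynomial σ K) (P : MvPolynomial σ K) : MvPolynomial σ K :=
  ∑ k ∈ B, S k * blockFlat B ψ (pderiv k P)

variable {B}
variable {ψ : MvPolynomial σ K →ₐ[K] MvPolynomial σ K} {S : σ → MvPolynomial σ K}

/-- [cite: HauserWagner2014, (T) translational move (arXiv p. 14)] (derived here) -/
theorem blockFlat_X_of_mem {i : σ} (h : i ∈ B) : blockFlat B ψ (X i) = X i := by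
  rw [blockFlat, aeval_X, if_pos h]

/-- [cite: HauserWagner2014, (T) translational move (arXiv p. 14)] (derived here) -/
theorem blockFlat_X_of_not_mem {i : σ} (h : i ∉ B) : blockFlat B ψ (X i) = ψ (X i) := by
  rw [blockFlat, aeval_X, if_neg h]

/-- The flat part preserves the block grading as soon as `ψ` maps the off-block variables to
`B`-free polynomials (derived here).
[cite: AbramovichTemkinWlodarczyk2024, §3.4 (p. 1570)] -/
theorem isWeightedHomogeneous_blockFlat
    (hψ0 : ∀ i ∉ B, IsWeightedHomogeneous (blockWeight B) (ψ (X i)) 0)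
    {P : MvPolynomial σ K} {n : ℕ} (hP : IsWeightedHomogeneous (blockWeight B) P n) :
    IsWeightedHomogeneous (blockWeight B) (blockFlat B ψ P) n := by
  refine isWeightedHomogeneous_aeval (blockWeight B) _ (fun i => ?_) hP
  by_cases hi : i ∈ B
  · rw [if_pos hi]; exact isWeightedHomogeneous_X K _ i
  · rw [if_neg hi, blockWeight_of_not_mem hi]; exact hψ0 i hi

/-- [cite: HauserWagner2014, (T) translational move (arXiv p. 14)] (derived here) -/
theorem blockDifferential_add (P Q : MvPolynomial σ K) :
    blockDifferential B ψ S (P + Q) = blockDifferential B ψ S P + blockDifferential B ψ S Q := by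
  simp only [blockDifferential, map_add, mul_add, Finset.sum_add_distrib]

/-- [cite: HauserWagner2014, (T) translational move (arXiv p. 14)] (derived here) -/
theorem blockDifferential_zero : blockDifferential B ψ S (0 : MvPolynomial σ K) = 0 := by
  simp only [blockDifferential, map_zero, mul_zero, Finset.sum_const_zero]

/-- Leibniz rule for the first-order part (derived here).
[cite: HauserWagner2014, (T) translational move (arXiv p. 14)] -/
theorem blockDifferential_mul (P Q : MvPolynomial σ K) :
    blockDifferential B ψ S (P * Q) =
      blockDifferential B ψ S P * blockFlat B ψ Q + blockFlat B ψ P * blockDifferential B ψ S Q := by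
  simp only [blockDifferential, pderiv_mul, map_add, map_mul, mul_add, Finset.sum_add_distrib,
    Finset.sum_mul, Finset.mul_sum]
  congr 1 <;> exact Finset.sum_congr rfl fun k _ => by ring

/-- [cite: HauserWagner2014, (T) translational move (arXiv p. 14)] (derived here) -/
theorem blockDifferential_C (c : K) : blockDifferential B ψ S (C c : MvPolynomial σ K) = 0 := by
  simp only [blockDifferential, pderiv_C, map_zero, mul_zero, Finset.sum_const_zero]

/-! ## §2 Derivatives and the block grading -/

/-- `∂ₖ` (`k ∈ B`) lowers the block degree by one (derived here).
[cite: Hironaka1970AdditiveGroups, differential operators on forms] -/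
theorem isWeightedHomogeneous_pderiv_of_mem {k : σ} (hk : k ∈ B) {P : MvPolynomial σ K} {m : ℕ}
    (hP : IsWeightedHomogeneous (blockWeight B) P (m + 1)) :
    IsWeightedHomogeneous (blockWeight B) (pderiv k P) m := by
  classical
  intro d hd
  rw [coeff_pderiv] at hd
  have h1 : coeff (d + Finsupp.single k 1) P ≠ 0 := fun h => hd (by rw [h, zero_mul])
  have h2 := hP h1
  rw [map_add, weight_single, blockWeight_of_mem hk, smul_eq_mul, mul_one] at h2
  omega

/-- A `B`-free polynomial is killed by `∂ₖ`, `k ∈ B` (derived here).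
[cite: Hironaka1970AdditiveGroups, differential operators on forms] -/
theorem pderiv_eq_zero_of_isWeightedHomogeneous_zero {k : σ} (hk : k ∈ B) {P : MvPolynomial σ K}
    (hP : IsWeightedHomogeneous (blockWeight B) P 0) : pderiv k P = 0 := by
  classical
  ext d
  rw [coeff_pderiv, coeff_zero]
  by_cases h : coeff (d + Finsupp.single k 1) P = 0
  · rw [h, zero_mul]
  · have h2 := hP h
    rw [map_add, weight_single, blockWeight_of_mem hk, smul_eq_mul, mul_one] at h2
    omega

/-- The first-order part of a polynomial of block degree `m + 1` has block degree `m`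
(derived here). [cite: HauserWagner2014, (T) translational move (arXiv p. 14)] -/
theorem isWeightedHomogeneous_blockDifferential
    (hS0 : ∀ k ∈ B, IsWeightedHomogeneous (blockWeight B) (S k) 0)
    (hψ0 : ∀ i ∉ B, IsWeightedHomogeneous (blockWeight B) (ψ (X i)) 0)
    {P : MvPolynomial σ K} {m : ℕ} (hP : IsWeightedHomogeneous (blockWeight B) P (m + 1)) :
    IsWeightedHomogeneous (blockWeight B) (blockDifferential B ψ S P) m := by
  refine IsWeightedHomogeneous.sum B _ m fun k hk => ?_
  have := (hS0 k hk).mul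
    (isWeightedHomogeneous_blockFlat hψ0 (isWeightedHomogeneous_pderiv_of_mem hk hP))
  rwa [zero_add] at this

/-! ## §3 First-order Taylor expansion with remainder (internal bookkeeping) -/

/-- `WtLE w c n P`: every monomial of `P` has `w`-weight at most `n - c` (stated additively). [folklore] -/
private def WtLE (w : σ → ℕ) (c n : ℕ) (P : MvPolynomial σ K) : Prop :=
  ∀ d ∈ P.support, weight w d + c ≤ n

omit [DecidableEq σ] in
/-- [folklore] -/
private theorem WtLE.zero {w : σ → ℕ} {c n : ℕ} : WtLE w c n (0 : MvPolynomial σ K) :=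
  fun d hd => by simp at hd

/-- [folklore] -/
private theorem WtLE.add {w : σ → ℕ} {c n : ℕ} {P Q : MvPolynomial σ K} (hP : WtLE w c n P)
    (hQ : WtLE w c n Q) : WtLE w c n (P + Q) := by
  classical
  intro d hd
  rcases Finset.mem_union.mp (MvPolynomial.support_add hd) with h | h
  exacts [hP d h, hQ d h]

/-- Weights add under multiplication of monomials (`support_mul`). [folklore] -/
private theorem WtLE.mul {w : σ → ℕ} {c₁ c₂ n₁ n₂ : ℕ} {P Q : MvPolynomial σ K}
    (hP : WtLE w c₁ n₁ P) (hQ : WtLE w c₂ n₂ Q) : WtLE w (c₁ + c₂) (n₁ + n₂) (P * Q) := by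
  classical
  intro d hd
  obtain ⟨d₁, hd₁, d₂, hd₂, rfl⟩ := Finset.mem_add.mp (support_mul P Q hd)
  have h₁ := hP d₁ hd₁
  have h₂ := hQ d₂ hd₂
  rw [map_add]
  omega

omit [DecidableEq σ] in
/-- [folklore] -/
private theorem WtLE.mono {w : σ → ℕ} {c c' n : ℕ} {P : MvPolynomial σ K} (hP : WtLE w c n P)
    (h : c' ≤ c) : WtLE w c' n P :=
  fun d hd => by have := hP d hd; omega

omit [DecidableEq σ] in
/-- [folklore] -/
private theorem WtLE.of_isWeightedHomogeneous {w : σ → ℕ} {n : ℕ} {P : MvPolynomial σ K}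
    (hP : IsWeightedHomogeneous w P n) : WtLE w 0 n P :=
  fun d hd => by have := hP (MvPolynomial.mem_support_iff.mp hd); omega

omit [DecidableEq σ] in
/-- [folklore] -/
private theorem WtLE.component_eq_zero {w : σ → ℕ} {c n j : ℕ} {P : MvPolynomial σ K}
    (hP : WtLE w c n P) (hj : n < j + c) : weightedHomogeneousComponent w j P = 0 :=
  weightedHomogeneousComponent_eq_zero' j P fun d hd => by have := hP d hd; omega

/-- The first-order part has block degree one less (additive form, valid also in degree `0`). [folklore] -/
private theorem wtLE_blockDifferential
    (hS0 : ∀ k ∈ B, IsWeightedHomogeneous (blockWeight B) (S k) 0)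
    (hψ0 : ∀ i ∉ B, IsWeightedHomogeneous (blockWeight B) (ψ (X i)) 0)
    {P : MvPolynomial σ K} {n : ℕ} (hP : IsWeightedHomogeneous (blockWeight B) P n) :
    WtLE (blockWeight B) 1 n (blockDifferential B ψ S P) := by
  cases n with
  | zero =>
    have h0 : blockDifferential B ψ S P = 0 := by
      refine Finset.sum_eq_zero fun k hk => ?_
      rw [pderiv_eq_zero_of_isWeightedHomogeneous_zero hk hP, map_zero, mul_zero]
    rw [h0]; exact WtLE.zero
  | succ m =>
    intro d hd
    have := isWeightedHomogeneous_blockDifferential hS0 hψ0 hP (MvPolynomial.mem_support_iff.mp hd)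
    omega

variable (B ψ S) in
/-- First-order Taylor data: `ψ P = ψ♭ P + (first-order part) + (remainder two degrees down)`. [folklore] -/
private def TaylorRem (n : ℕ) (P : MvPolynomial σ K) : Prop :=
  ∃ R : MvPolynomial σ K, WtLE (blockWeight B) 2 n R ∧
    ψ P = blockFlat B ψ P + blockDifferential B ψ S P + R

/-- [folklore] -/
private theorem taylorRem_zero (n : ℕ) : TaylorRem B ψ S n 0 :=
  ⟨0, WtLE.zero, by simp only [map_zero, blockDifferential_zero, add_zero]⟩

/-- [folklore] -/
private theorem taylorRem_add {n : ℕ} {P Q : MvPolynomial σ K} (h₁ : TaylorRem B ψ S n P)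
    (h₂ : TaylorRem B ψ S n Q) : TaylorRem B ψ S n (P + Q) := by
  obtain ⟨R₁, hR₁, e₁⟩ := h₁
  obtain ⟨R₂, hR₂, e₂⟩ := h₂
  refine ⟨R₁ + R₂, hR₁.add hR₂, ?_⟩
  rw [map_add, map_add, blockDifferential_add, e₁, e₂]
  ring

/-- [folklore] -/
private theorem taylorRem_sum {ι : Type*} (s : Finset ι) (f : ι → MvPolynomial σ K) {n : ℕ}
    (h : ∀ i ∈ s, TaylorRem B ψ S n (f i)) : TaylorRem B ψ S n (∑ i ∈ s, f i) := by
  classical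
  induction s using Finset.induction_on with
  | empty => rw [Finset.sum_empty]; exact taylorRem_zero n
  | insert a s ha ih =>
    rw [Finset.sum_insert ha]
    exact taylorRem_add (h a (Finset.mem_insert_self a s))
      (ih fun i hi => h i (Finset.mem_insert_of_mem hi))

/-- Constants: `ψ (C c) = C c = ψ♭ (C c)`, no first-order part. [folklore] -/
private theorem taylorRem_C (c : K) (n : ℕ) : TaylorRem B ψ S n (C c) :=
  ⟨0, WtLE.zero, by rw [algHom_C, algHom_C, blockDifferential_C, add_zero, add_zero]⟩

/-- Variables: `ψ (X k) = X k + S k + 0` on the block, `ψ (X i) = ψ♭ (X i)` off it. [folklore] -/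
private theorem taylorRem_X (hS : ∀ k ∈ B, ψ (X k) = X k + S k) (i : σ) :
    TaylorRem B ψ S (blockWeight B i) (X i) := by
  classical
  refine ⟨0, WtLE.zero, ?_⟩
  rw [add_zero, blockDifferential]
  by_cases hi : i ∈ B
  · rw [hS i hi, blockFlat_X_of_mem hi, Finset.sum_eq_single_of_mem i hi]
    · rw [pderiv_X_self, map_one, mul_one]
    · intro k _ hki
      rw [pderiv_X_of_ne (Ne.symm hki), map_zero, mul_zero]
  · rw [blockFlat_X_of_not_mem hi, Finset.sum_eq_zero, add_zero]
    intro k hk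
    rw [pderiv_X_of_ne (fun h : i = k => hi (h ▸ hk)), map_zero, mul_zero]

/-- Products: Leibniz for the first-order part; all cross terms land two degrees down. [folklore] -/
private theorem taylorRem_mul (hS0 : ∀ k ∈ B, IsWeightedHomogeneous (blockWeight B) (S k) 0)
    (hψ0 : ∀ i ∉ B, IsWeightedHomogeneous (blockWeight B) (ψ (X i)) 0)
    {n₁ n₂ : ℕ} {P Q : MvPolynomial σ K}
    (hP : IsWeightedHomogeneous (blockWeight B) P n₁) (hQ : IsWeightedHomogeneous (blockWeight B) Q n₂)
    (h₁ : TaylorRem B ψ S n₁ P) (h₂ : TaylorRem B ψ S n₂ Q) :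
    TaylorRem B ψ S (n₁ + n₂) (P * Q) := by
  obtain ⟨R₁, hR₁, e₁⟩ := h₁
  obtain ⟨R₂, hR₂, e₂⟩ := h₂
  have hFP : WtLE (blockWeight B) 0 n₁ (blockFlat B ψ P) :=
    WtLE.of_isWeightedHomogeneous (isWeightedHomogeneous_blockFlat hψ0 hP)
  have hFQ : WtLE (blockWeight B) 0 n₂ (blockFlat B ψ Q) :=
    WtLE.of_isWeightedHomogeneous (isWeightedHomogeneous_blockFlat hψ0 hQ)
  have hDP : WtLE (blockWeight B) 1 n₁ (blockDifferential B ψ S P) := wtLE_blockDifferential hS0 hψ0 hP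
  have hDQ : WtLE (blockWeight B) 1 n₂ (blockDifferential B ψ S Q) := wtLE_blockDifferential hS0 hψ0 hQ
  refine ⟨blockDifferential B ψ S P * blockDifferential B ψ S Q + blockFlat B ψ P * R₂ +
      blockDifferential B ψ S P * R₂ + R₁ * blockFlat B ψ Q + R₁ * blockDifferential B ψ S Q +
      R₁ * R₂, ?_, ?_⟩
  · exact (((((hDP.mul hDQ).mono le_rfl).add ((hFP.mul hR₂).mono le_rfl)).add
      ((hDP.mul hR₂).mono (by norm_num))).add ((hR₁.mul hFQ).mono le_rfl)).add
      ((hR₁.mul hDQ).mono (by norm_num)) |>.add ((hR₁.mul hR₂).mono (by norm_num))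
  · rw [map_mul, e₁, e₂, map_mul, blockDifferential_mul]
    ring

/-- [folklore] -/
private theorem taylorRem_prod (hS0 : ∀ k ∈ B, IsWeightedHomogeneous (blockWeight B) (S k) 0)
    (hψ0 : ∀ i ∉ B, IsWeightedHomogeneous (blockWeight B) (ψ (X i)) 0)
    {ι : Type*} (s : Finset ι) (f : ι → MvPolynomial σ K) (deg : ι → ℕ)
    (hf : ∀ i ∈ s, IsWeightedHomogeneous (blockWeight B) (f i) (deg i))
    (ht : ∀ i ∈ s, TaylorRem B ψ S (deg i) (f i)) :
    TaylorRem B ψ S (∑ i ∈ s, deg i) (∏ i ∈ s, f i) := by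
  classical
  induction s using Finset.induction_on with
  | empty => rw [Finset.sum_empty, Finset.prod_empty, ← C_1]; exact taylorRem_C 1 0
  | insert a s ha ih =>
    rw [Finset.prod_insert ha, Finset.sum_insert ha]
    exact taylorRem_mul hS0 hψ0 (hf a (Finset.mem_insert_self a s))
      (IsWeightedHomogeneous.prod s f deg fun i hi => hf i (Finset.mem_insert_of_mem hi))
      (ht a (Finset.mem_insert_self a s))
      (ih (fun i hi => hf i (Finset.mem_insert_of_mem hi))
        (fun i hi => ht i (Finset.mem_insert_of_mem hi)))

/-- [folklore] -/
private theorem taylorRem_X_pow (hS : ∀ k ∈ B, ψ (X k) = X k + S k)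
    (hS0 : ∀ k ∈ B, IsWeightedHomogeneous (blockWeight B) (S k) 0)
    (hψ0 : ∀ i ∉ B, IsWeightedHomogeneous (blockWeight B) (ψ (X i)) 0) (i : σ) (e : ℕ) :
    TaylorRem B ψ S (e * blockWeight B i) (X i ^ e) := by
  induction e with
  | zero => rw [zero_mul, pow_zero, ← C_1]; exact taylorRem_C 1 0
  | succ e ih =>
    rw [pow_succ, Nat.succ_mul]
    refine taylorRem_mul hS0 hψ0 ?_ (isWeightedHomogeneous_X K _ i) ih (taylorRem_X hS i)
    simpa only [smul_eq_mul] using (isWeightedHomogeneous_X K (blockWeight B) i).pow e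

omit [DecidableEq σ] in
/-- [folklore] -/
private theorem weight_eq_sum_support (w : σ → ℕ) (d : σ →₀ ℕ) :
    weight w d = ∑ i ∈ d.support, d i * w i := by
  simp only [weight_apply, Finsupp.sum, smul_eq_mul]

/-- Monomials, by multiplicativity. [folklore] -/
private theorem taylorRem_monomial (hS : ∀ k ∈ B, ψ (X k) = X k + S k)
    (hS0 : ∀ k ∈ B, IsWeightedHomogeneous (blockWeight B) (S k) 0)
    (hψ0 : ∀ i ∉ B, IsWeightedHomogeneous (blockWeight B) (ψ (X i)) 0) (d : σ →₀ ℕ) (c : K) :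
    TaylorRem B ψ S (weight (blockWeight B) d) (monomial d c) := by
  rw [monomial_eq, Finsupp.prod, weight_eq_sum_support, ← zero_add (∑ i ∈ d.support, _)]
  refine taylorRem_mul hS0 hψ0 (isWeightedHomogeneous_C _ c) ?_ (taylorRem_C c 0)
    (taylorRem_prod hS0 hψ0 d.support (fun i => X i ^ d i) (fun i => d i * blockWeight B i) ?_ ?_)
  · exact IsWeightedHomogeneous.prod _ _ _ fun i _ => by
      simpa only [smul_eq_mul] using (isWeightedHomogeneous_X K (blockWeight B) i).pow (d i)
  · exact fun i _ => by
      simpa only [smul_eq_mul] using (isWeightedHomogeneous_X K (blockWeight B) i).pow (d i)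
  · exact fun i _ => taylorRem_X_pow hS hS0 hψ0 i (d i)

/-- Block-homogeneous polynomials, by additivity over their monomials. [folklore] -/
private theorem taylorRem_of_isWeightedHomogeneous (hS : ∀ k ∈ B, ψ (X k) = X k + S k)
    (hS0 : ∀ k ∈ B, IsWeightedHomogeneous (blockWeight B) (S k) 0)
    (hψ0 : ∀ i ∉ B, IsWeightedHomogeneous (blockWeight B) (ψ (X i)) 0)
    {P : MvPolynomial σ K} {n : ℕ} (hP : IsWeightedHomogeneous (blockWeight B) P n) :
    TaylorRem B ψ S n P := by
  rw [as_sum P]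
  refine taylorRem_sum _ _ fun d hd => ?_
  have hw : weight (blockWeight B) d = n := hP (MvPolynomial.mem_support_iff.mp hd)
  exact hw ▸ taylorRem_monomial hS hS0 hψ0 d (coeff d P)

/-! ## §4 Block substitutions: the top two layers of `ψ P` -/

variable (B ψ S) in
/-- `ψ` is a **block substitution** at the block `B` with shifts `S`: `ψ (X k) = X k + S k` on the
block with `B`-free shifts, and `ψ (X i)` is `B`-free off the block (derived here; in the block
step: `ψ` fixes `y_<`, shifts `y_B` by `S_B(y_>)`, and maps the lower variables among themselves).
[cite: HauserWagner2014, (T) translational move F*(y,z) = F(yz+tz,z) (arXiv p. 14)]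
[cite: AbramovichTemkinWlodarczyk2024, §5.2 (pp. 1576–1577)] -/
structure IsBlockSubstitution : Prop where
  /-- on the block, `ψ` is the shift by `S` -/
  map_X_of_mem : ∀ k ∈ B, ψ (X k) = X k + S k
  /-- the shifts are `B`-free -/
  shift_free : ∀ k ∈ B, IsWeightedHomogeneous (blockWeight B) (S k) 0
  /-- off the block, `ψ` takes `B`-free values -/
  map_X_free : ∀ i ∉ B, IsWeightedHomogeneous (blockWeight B) (ψ (X i)) 0

namespace IsBlockSubstitution

/-- **Top layer.**  For `P` of block degree `n`, the block-degree-`n` part of `ψ P` is `ψ♭ P`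
(derived here). [cite: HauserWagner2014, (T) translational move (arXiv p. 14)] -/
theorem weightedHomogeneousComponent_map_top (hψ : IsBlockSubstitution B ψ S)
    {P : MvPolynomial σ K} {n : ℕ} (hP : IsWeightedHomogeneous (blockWeight B) P n) :
    weightedHomogeneousComponent (blockWeight B) n (ψ P) = blockFlat B ψ P := by
  classical
  obtain ⟨R, hR, e⟩ := taylorRem_of_isWeightedHomogeneous hψ.1 hψ.2 hψ.3 hP
  rw [e, map_add, map_add,
    weightedHomogeneousComponent_of_mem (isWeightedHomogeneous_blockFlat hψ.3 hP), if_pos rfl,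
    (wtLE_blockDifferential hψ.2 hψ.3 hP).component_eq_zero (Nat.lt_succ_self n),
    hR.component_eq_zero (by omega), add_zero, add_zero]

/-- **No layer above the top.**  For `P` of block degree `n`, `ψ P` has no part of block degree
`> n` (derived here). [cite: HauserWagner2014, (T) translational move (arXiv p. 14)] -/
theorem weightedHomogeneousComponent_map_eq_zero_of_lt (hψ : IsBlockSubstitution B ψ S)
    {P : MvPolynomial σ K} {n : ℕ} (hP : IsWeightedHomogeneous (blockWeight B) P n) {j : ℕ}
    (hj : n < j) : weightedHomogeneousComponent (blockWeight B) j (ψ P) = 0 := by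
  classical
  obtain ⟨R, hR, e⟩ := taylorRem_of_isWeightedHomogeneous hψ.1 hψ.2 hψ.3 hP
  rw [e, map_add, map_add,
    weightedHomogeneousComponent_of_mem (isWeightedHomogeneous_blockFlat hψ.3 hP),
    if_neg (by omega : j ≠ n),
    (wtLE_blockDifferential hψ.2 hψ.3 hP).component_eq_zero (by omega),
    hR.component_eq_zero (by omega), add_zero, add_zero]

/-- **First-order Taylor formula in block degree.**  For `P` of block degree `m + 1`, the part of
`ψ P` of block degree `m` is `Σ_{k ∈ B} S k · ψ♭ (∂ₖ P)` (derived here; "choose exactly one factor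
`S k` in `(X_B + S)^β`").
[cite: HauserWagner2014, (T) translational move F*(y,z) = F(yz+tz,z) (arXiv p. 14–15)] -/
theorem weightedHomogeneousComponent_map_sub_one (hψ : IsBlockSubstitution B ψ S)
    {P : MvPolynomial σ K} {m : ℕ} (hP : IsWeightedHomogeneous (blockWeight B) P (m + 1)) :
    weightedHomogeneousComponent (blockWeight B) m (ψ P) = blockDifferential B ψ S P := by
  classical
  obtain ⟨R, hR, e⟩ := taylorRem_of_isWeightedHomogeneous hψ.1 hψ.2 hψ.3 hP
  rw [e, map_add, map_add,
    weightedHomogeneousComponent_of_mem (isWeightedHomogeneous_blockFlat hψ.3 hP),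
    if_neg (Nat.succ_ne_self m).symm,
    weightedHomogeneousComponent_of_mem (isWeightedHomogeneous_blockDifferential hψ.2 hψ.3 hP),
    if_pos rfl, hR.component_eq_zero (by omega), zero_add, add_zero]

/-! ## §5 The layer lemma and the layer equation (⋆) -/

omit [DecidableEq σ] in
/-- A polynomial all of whose monomials have `w`-weight `≤ E` is the sum of its weighted
homogeneous components of weights `0, …, E` (derived here).
[cite: AbramovichTemkinWlodarczyk2024, §3.4 (p. 1570)] -/
theorem sum_range_weightedHomogeneousComponent {w : σ → ℕ} {H : MvPolynomial σ K} {E : ℕ}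
    (hH : ∀ d ∈ H.support, weight w d ≤ E) :
    ∑ j ∈ Finset.range (E + 1), weightedHomogeneousComponent w j H = H := by
  classical
  ext d
  rw [coeff_sum]
  simp only [coeff_weightedHomogeneousComponent]
  rw [Finset.sum_ite_eq]
  by_cases hd : weight w d ∈ Finset.range (E + 1)
  · rw [if_pos hd]
  · rw [if_neg hd]
    by_contra hne
    exact hd (Finset.mem_range.mpr (Nat.lt_succ_of_le (hH d (MvPolynomial.mem_support_iff.mpr (Ne.symm hne)))))

/-- **Layer lemma.**  If every monomial of `H` has block degree `≤ m + 1`, then the part of `ψ H`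
of block degree `m` is `ψ♭ [H]ₘ + Σ_{k ∈ B} S k · ψ♭ (∂ₖ [H]ₘ₊₁)`: the layer `[H]ₘ` contributes
through its flat image, the top layer `[H]ₘ₊₁` through its first-order part, lower layers not at
all (derived here).
[cite: HauserWagner2014, (T) translational move F*(y,z) = F(yz+tz,z) (arXiv p. 14–15)] -/
theorem layer_eq (hψ : IsBlockSubstitution B ψ S) {H : MvPolynomial σ K} {m : ℕ}
    (hH : ∀ d ∈ H.support, weight (blockWeight B) d ≤ m + 1) :
    weightedHomogeneousComponent (blockWeight B) m (ψ H) =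
      blockFlat B ψ (weightedHomogeneousComponent (blockWeight B) m H) +
        blockDifferential B ψ S (weightedHomogeneousComponent (blockWeight B) (m + 1) H) := by
  classical
  conv_lhs => rw [← sum_range_weightedHomogeneousComponent hH, map_sum, map_sum,
    Finset.sum_range_succ, Finset.sum_range_succ]
  rw [Finset.sum_eq_zero fun j hj => hψ.weightedHomogeneousComponent_map_eq_zero_of_lt
      (weightedHomogeneousComponent_isWeightedHomogeneous j H) (Finset.mem_range.mp hj),
    zero_add, hψ.weightedHomogeneousComponent_map_top
      (weightedHomogeneousComponent_isWeightedHomogeneous m H),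
    hψ.weightedHomogeneousComponent_map_sub_one
      (weightedHomogeneousComponent_isWeightedHomogeneous (m + 1) H)]

/-- **Top layer is flat-invariant under the face equation.**  If every monomial of `H` has block
degree `≤ E` and `ψ H = H - C c` with `E ≠ 0`, then `ψ♭ [H]_E = [H]_E` (derived here).
[cite: HauserWagner2014, (T) translational move (arXiv p. 14–15)] -/
theorem blockFlat_top_eq (hψ : IsBlockSubstitution B ψ S) {H : MvPolynomial σ K} {E : ℕ}
    (hH : ∀ d ∈ H.support, weight (blockWeight B) d ≤ E) (hE : E ≠ 0) {c : K} (hQ : ψ H = H - C c) :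
    blockFlat B ψ (weightedHomogeneousComponent (blockWeight B) E H) =
      weightedHomogeneousComponent (blockWeight B) E H := by
  classical
  have h1 : weightedHomogeneousComponent (blockWeight B) E (ψ H) =
      blockFlat B ψ (weightedHomogeneousComponent (blockWeight B) E H) := by
    conv_lhs => rw [← sum_range_weightedHomogeneousComponent hH, map_sum, map_sum,
      Finset.sum_range_succ]
    rw [Finset.sum_eq_zero fun j hj => hψ.weightedHomogeneousComponent_map_eq_zero_of_lt
        (weightedHomogeneousComponent_isWeightedHomogeneous j H) (Finset.mem_range.mp hj),
      zero_add, hψ.weightedHomogeneousComponent_map_top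
        (weightedHomogeneousComponent_isWeightedHomogeneous E H)]
  rw [← h1, hQ, map_sub, weightedHomogeneousComponent_of_mem (isWeightedHomogeneous_C _ c),
    if_neg hE, sub_zero]

/-- **The layer equation (⋆).**  If every monomial of `H` has block degree `≤ m + 1`, `m ≠ 0`
(the entry of the block is not `1`), and `H` satisfies the face equation `ψ H = H - C c`, then
`Σ_{k ∈ B} S k · ψ♭ (∂ₖ [H]ₘ₊₁) = [H]ₘ - ψ♭ [H]ₘ`, i.e. `M · S_B = -δ_>(n)` with `M` the
coefficient matrix of `v ↦ Σ_k v_k ∂ₖ [H]ₘ₊₁` and `δ_>(n) = ψ♭ n - n` on the layer `n = [H]ₘ`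
(derived here; the comparison of coefficients in block degree `m` of the face equation).
[cite: HauserWagner2014, (T) translational move F*(y,z) = F(yz+tz,z) (arXiv p. 14–15)]
[cite: AbramovichTemkinWlodarczyk2024, §5.2 (pp. 1576–1577)] -/
theorem layer_equation (hψ : IsBlockSubstitution B ψ S) {H : MvPolynomial σ K} {m : ℕ}
    (hH : ∀ d ∈ H.support, weight (blockWeight B) d ≤ m + 1) (hm : m ≠ 0) {c : K}
    (hQ : ψ H = H - C c) :
    blockDifferential B ψ S (weightedHomogeneousComponent (blockWeight B) (m + 1) H) =
      weightedHomogeneousComponent (blockWeight B) m H -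
        blockFlat B ψ (weightedHomogeneousComponent (blockWeight B) m H) := by
  classical
  have h1 := hψ.layer_eq hH
  rw [hQ, map_sub, weightedHomogeneousComponent_of_mem (isWeightedHomogeneous_C _ c), if_neg hm,
    sub_zero] at h1
  rw [eq_sub_iff_add_eq, add_comm]
  exact h1.symm

/-- **Kernel form of the coefficient matrix.**  The first-order part is linear in the shift
vector: for constant shifts `v`, `blockDifferential B ψ (C ∘ v) F = Σ_k v_k · ψ♭ (∂ₖ F)`, so
`M(0) · v = 0` reads `Σ_k v_k ∂ₖ f = 0` on the top forms (derived here; definitional unfolding,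
recorded for reference). [cite: Hironaka1970AdditiveGroups, differential operators on forms] -/
theorem blockDifferential_const (v : σ → K) (F : MvPolynomial σ K) :
    blockDifferential B ψ (fun k => C (v k)) F = ∑ k ∈ B, v k • blockFlat B ψ (pderiv k F) := by
  simp only [blockDifferential, smul_eq_C_mul]

end IsBlockSubstitution

end Block

/-! ## §6 The derivative criterion in characteristic `p` -/

/-- If `∂ₖ F = 0` in characteristic `p`, every exponent of `X k` occurring in `F` is divisible by
`p` (derived here). [cite: Hironaka1970AdditiveGroups, additive forms and differential operators] -/
theorem dvd_of_pderiv_eq_zero (p : ℕ) [CharP K p] {F : MvPolynomial σ K} {i : σ}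
    (hF : pderiv i F = 0) {d : σ →₀ ℕ} (hd : d ∈ F.support) : p ∣ d i := by
  classical
  by_cases h0 : d i = 0
  · rw [h0]; exact dvd_zero p
  have key := coeff_pderiv F (d - Finsupp.single i 1) (i := i)
  have hsub : d - Finsupp.single i 1 + Finsupp.single i 1 = d :=
    tsub_add_cancel_of_le (Finsupp.single_le_iff.mpr (Nat.one_le_iff_ne_zero.mpr h0))
  rw [hF, coeff_zero, hsub, Finsupp.tsub_apply, Finsupp.single_eq_same] at key
  have h1 : d i - 1 + 1 = d i := by omega
  have hcast : ((d i - 1 : ℕ) : K) + 1 = (d i : K) := by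
    rw [← Nat.cast_add_one, h1]
  rw [hcast] at key
  have hdi : (d i : K) = 0 := by
    rcases mul_eq_zero.mp key.symm with h | h
    · exact absurd h (MvPolynomial.mem_support_iff.mp hd)
    · exact h
  exact (CharP.cast_eq_zero_iff K p (d i)).mp hdi

/-- **Derivative criterion.**  If `∂ₖ F = 0` in characteristic `p` and every exponent of `X k`
in `F` is `< p` (e.g. `F` a form of degree `< p`), then `X k` does not occur in `F` (derived here;
"an exponent in `[1, p-1]` would survive `∂ₖ`").
[cite: Hironaka1970AdditiveGroups, additive forms and differential operators] -/
theorem notMem_vars_of_pderiv_eq_zero (p : ℕ) [CharP K p] {F : MvPolynomial σ K} {i : σ}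
    (hF : pderiv i F = 0) (hlt : ∀ d ∈ F.support, d i < p) : i ∉ F.vars := by
  classical
  intro hi
  obtain ⟨d, hd, hdi⟩ := (mem_vars_iff_mem_support i).mp hi
  have h0 : d i = 0 := Nat.eq_zero_of_dvd_of_lt (dvd_of_pderiv_eq_zero p hF hd) (hlt d hd)
  exact (Finsupp.mem_support_iff.mp hdi) h0

/-- The degree form of the criterion: `∂ₖ F = 0` and `totalDegree F < p` force `X k ∉ vars F`
(derived here). [cite: Hironaka1970AdditiveGroups, additive forms and differential operators] -/
theorem notMem_vars_of_pderiv_eq_zero_of_totalDegree_lt (p : ℕ) [CharP K p]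
    {F : MvPolynomial σ K} {i : σ} (hF : pderiv i F = 0) (hdeg : F.totalDegree < p) :
    i ∉ F.vars :=
  notMem_vars_of_pderiv_eq_zero p hF fun d hd =>
    lt_of_le_of_lt (le_trans (Finsupp.le_degree i d) (le_totalDegree hd)) hdeg

/-! ## §7 A worked instance -/

section Instance

/-- The block substitution `X₁ ↦ X₁ + X₂², X₀ ↦ X₀, X₂ ↦ X₂` on `K[X₀,X₁,X₂]`, block `{1}`. [folklore] -/
private noncomputable def ψex : MvPolynomial (Fin 3) K →ₐ[K] MvPolynomial (Fin 3) K :=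
  aeval ![X 0, X 1 + X 2 ^ 2, X 2]

/-- [folklore] -/
private theorem ψex_isBlockSubstitution :
    IsBlockSubstitution ({1} : Finset (Fin 3)) (ψex (K := K)) (fun _ => X 2 ^ 2) := by
  have h2 : (2 : Fin 3) ∉ ({1} : Finset (Fin 3)) := by decide
  have h0 : (0 : Fin 3) ∉ ({1} : Finset (Fin 3)) := by decide
  have hfree : IsWeightedHomogeneous (blockWeight ({1} : Finset (Fin 3)))
      (X 2 ^ 2 : MvPolynomial (Fin 3) K) 0 := by
    simpa only [blockWeight_of_not_mem h2, smul_eq_mul, mul_zero] using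
      (isWeightedHomogeneous_X K (blockWeight ({1} : Finset (Fin 3))) (2 : Fin 3)).pow 2
  refine ⟨fun k hk => ?_, fun k _ => hfree, fun i hi => ?_⟩
  · rw [Finset.mem_singleton] at hk; subst hk
    simp [ψex]
  · fin_cases i
    · simpa [ψex, blockWeight_of_not_mem h0] using
        isWeightedHomogeneous_X K (blockWeight ({1} : Finset (Fin 3))) (0 : Fin 3)
    · exact absurd (Finset.mem_singleton_self _) hi
    · simpa [ψex, blockWeight_of_not_mem h2] using
        isWeightedHomogeneous_X K (blockWeight ({1} : Finset (Fin 3))) (2 : Fin 3)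

/-- First-order Taylor in the instance: the block-degree-`1` part of `ψ (X₀ X₁²) = X₀ (X₁ + X₂²)²`
is `X₂² · (X₀ · 2 X₁)` = `S₁ · ∂₁(X₀ X₁²)`. -/
example : weightedHomogeneousComponent (blockWeight ({1} : Finset (Fin 3))) 1
      (ψex (X 0 * X 1 ^ 2 : MvPolynomial (Fin 3) K)) =
    X 2 ^ 2 * (X 0 * (2 * X 1)) := by
  have h0 : (0 : Fin 3) ∉ ({1} : Finset (Fin 3)) := by decide
  have h1 : (1 : Fin 3) ∈ ({1} : Finset (Fin 3)) := Finset.mem_singleton_self _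
  have hP : IsWeightedHomogeneous (blockWeight ({1} : Finset (Fin 3)))
      (X 0 * X 1 ^ 2 : MvPolynomial (Fin 3) K) (1 + 1) := by
    have := (isWeightedHomogeneous_X K (blockWeight ({1} : Finset (Fin 3))) (0 : Fin 3)).mul
      ((isWeightedHomogeneous_X K (blockWeight ({1} : Finset (Fin 3))) (1 : Fin 3)).pow 2)
    simpa only [blockWeight_of_not_mem h0, blockWeight_of_mem h1, smul_eq_mul, mul_one, zero_add]
      using this
  rw [ψex_isBlockSubstitution.weightedHomogeneousComponent_map_sub_one hP, blockDifferential,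
    Finset.sum_singleton]
  simp [blockFlat, ψex]

end Instance

end Literature.AlgebraicGeometry.Resolution.WeightedBlowup
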